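import Summits.QuantumFields.BalabanUV.T4Continuum.Support.SubstrateFibredAxial
import Summits.QuantumFields.BalabanUV.T4Continuum.Support.SubstrateFibredAveraging

/-!
# SUBSTRATE — the axial average AS A `FibredAveraging`, and its fibre transport as a renormalization transform

Cell `pub-balaban`, SUBSTRATE cell, seat `b2b-balaban-substrate-p2`; registry item S-F2, the packaging companion of
`Support/SubstrateFibredAxial` (the construction `phiAx = fill ∘ shear` with `axialAvg_phiAx`, `measurable_phiAx`, `map_phiAx`) into the structure
of `Support/SubstrateFibredAveraging` (typer sketch v0.2 §F2 `FibredAxial_stmt`).  Summits-side bookkeeping BY NAME; edits nothing.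

HONEST FRAMING (T4-DAG p. 1).  Rung (B)+1 of the FINITE-VOLUME T⁴ continuum programme — NOT infinite volume, NOT a mass gap, NOT the
Clay problem, NOT summit progress, no estimate.  The axial average is the tree's inhabitant of `Setup.Averaging`, not Bałaban's weighted
block average.  HONEST DEPENDENCY (cell line, verbatim): continuum YM on T⁴ ⇐ BetaPertH ∧ nine spine estimates (0/9 proved); BetaPertH ⇐
(D1) ∧ (D4) ∧ CAP+tail; G-an2-4 gates asym, D1 and NE2/3/4.

* **`fibredAxial hj : FibredAveraging P j G axialAvg`** (fluctuation variables = the non-last bond variables with product Haar);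
  `nonempty_fibredAveraging_axial` (= `FibredAxial_stmt`, with the measurability instances `MeasurableMul₂ G`, `MeasurableInv G` explicit);
* **`isRT_fibreTransport_axial`**: the axial fibre transport `(Tρ)(V) = ∫ ρ(phiAx(z, V)) dμ_Z` is a renormalization transform of every
  integrable density (by `SubstrateFibredAveraging.isRT_fibreTransport` and `AveragingRT.measurable_axialAvg`), and
  `fibreTransport_axial_ae_eq`: it agrees a.e. with the transport of record `AveragingRT.rnTransport axialAvg`.
No estimate, no `def … : Prop`, no `sorry`.  References (KIND only): [Balaban1984PropagatorsI] (1.7) p. 18; [Balaban1985Averaging] (10) p. 19.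
-/

noncomputable section

open _root_.MeasureTheory

namespace Summit.QuantumFields.BalabanUV.T4Continuum.SubstrateFibredAxialRT

open Literature.MathematicalPhysics.QuantumFieldTheory.Balaban1983to89
open Literature.MathematicalPhysics.QuantumFieldTheory.Balaban1983to89.AveragingRT (axialAvg)
open Summit.QuantumFields.BalabanUV.T4Continuum.SubstrateFibredAveraging
open Summit.QuantumFields.BalabanUV.T4Continuum.SubstrateFibredAxial

variable {P : Params} {j : ℕ} {G : Type} [GaugeGroup G] [MeasurableSpace G] [HaarData G] [MeasurableMul₂ G] [MeasurableInv G]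

/-- [folklore] **THE AXIAL AVERAGE IS FIBRED** (typer's `FibredAxial_stmt`, with the measurability structure on `G` explicit): fluctuation
variables = the non-last bond variables with product Haar, parametrisation = fill ∘ shear. -/
def fibredAxial (hj : j + 1 ≤ P.m + P.K) :
    FibredAveraging P j G (axialAvg : GaugeField P j G → GaugeField P (j + 1) G) where
  Z := Z P j G
  μZ := muZ P j G
  Φ := phiAx hj
  measurable_Φ := measurable_phiAx hj
  avg_Φ := axialAvg_phiAx hj
  map_Φ := map_phiAx hj

/-- [folklore] `FibredAxial_stmt` in its `Nonempty` form. -/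
theorem nonempty_fibredAveraging_axial (hj : j + 1 ≤ P.m + P.K) :
    Nonempty (FibredAveraging P j G (axialAvg : GaugeField P j G → GaugeField P (j + 1) G)) :=
  ⟨fibredAxial hj⟩

/-- [folklore] **THE AXIAL FIBRE TRANSPORT IS A RENORMALIZATION TRANSFORM** of every integrable density (by name from
`SubstrateFibredAveraging.isRT_fibreTransport` and `AveragingRT.measurable_axialAvg`) — an everywhere-defined `(Tρ)(V)` for the axial
scheme, equal a.e. to the transport of record (`fibreTransport_ae_eq_rnTransport`). -/
theorem isRT_fibreTransport_axial (hj : j + 1 ≤ P.m + P.K) {ρ : Density P j G} (hρ : Integrable ρ (fieldMeasure P j G)) :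
    IsRT axialAvg ρ (fibreTransport (fibredAxial (G := G) hj) ρ) :=
  isRT_fibreTransport _ AveragingRT.measurable_axialAvg hρ

/-- [folklore] … and it agrees a.e. with the transport of record. -/
theorem fibreTransport_axial_ae_eq (hj : j + 1 ≤ P.m + P.K) {ρ : Density P j G} (hρ : Integrable ρ (fieldMeasure P j G)) :
    fibreTransport (fibredAxial (G := G) hj) ρ =ᵐ[fieldMeasure P (j + 1) G] AveragingRT.rnTransport axialAvg ρ :=
  fibreTransport_ae_eq_rnTransport _ AveragingRT.measurable_axialAvg hρ

end Summit.QuantumFields.BalabanUV.T4Continuum.SubstrateFibredAxialRT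

end
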